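import Mathlib.MeasureTheory.Measure.ProbabilityMeasure
import HarnessLib

/-!
# Transfer of weak limits along asymptotic couplings ("convergence together", coupling form)

Topic `Literature/Probability/Distributions` (general measure theory; everything is proved, no
named fact is introduced).  Companion of `WeakConvergenceCoupling.lean` (weak convergence ⇒
couplings close to the diagonal); this file is the converse, elementary direction:

* `FiniteMeasure.tendsto_of_forall_coupling` — if `μs i → μ` weakly (finite Borel measures on a
  topological space `Ω`, Mathlib's topology of weak convergence on `FiniteMeasure Ω`) and for every
  open, measurable neighbourhood `N` of the diagonal of `Ω × Ω` and every `ε > 0`, eventually there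
  is a coupling `π` of `μs i` and `νs i` (a measure on `Ω × Ω` with these two marginals) with
  `π(Nᶜ) ≤ ε`, then `νs i → μ` weakly as well;
* `ProbabilityMeasure.tendsto_of_forall_coupling` — the same for `ProbabilityMeasure Ω`.

This is the metric-free form of Billingsley's "convergence together" theorem (P. Billingsley,
*Convergence of Probability Measures*, 2nd ed. (1999), Thm. 3.1: "if `(Xₙ, Yₙ)` are random
elements of `S × S`, `Xₙ ⇒ X` and `ρ(Xₙ, Yₙ) ⇒ 0`, then `Yₙ ⇒ X`"): on a metric space the sets
`{ρ < η}` form a basis of neighbourhoods of the diagonal among the sets used here, and no metric,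
separability or completeness is needed for this direction.  Proof: test a bounded continuous
`f : Ω →ᵇ ℝ` (`FiniteMeasure.tendsto_iff_forall_integral_tendsto`) and use the neighbourhood
`N = {dist (f x) (f y) < η}`: under a coupling `π`,
`|∫ f dνs i - ∫ f dμs i| = |∫ (f y - f x) dπ| ≤ η · mass (μs i) + 2‖f‖ · π(Nᶜ)`.

Used by `Summits/CriticalPhenomena/CardyFormulaZ2/Theorems/CardySelfRefinementRotationInput.lean`
(rotation invariance of subsequential quad-crossing limits from DKKMO's couplings).

## References

* P. Billingsley, *Convergence of Probability Measures*, 2nd ed., Wiley (1999), Thm. 3.1.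
  [Billingsley1999]
-/

noncomputable section

open Set Filter
open _root_.MeasureTheory _root_.Topology
open scoped BoundedContinuousFunction ENNReal NNReal

namespace Literature.Probability.Distributions

variable {Ω : Type*} [TopologicalSpace Ω]

/-- Pointwise bound behind the coupling transfer: for a bounded continuous `f` and `η ≥ 0`,
`|f y - f x| ≤ η` on `N = {dist (f x) (f y) < η}` and `≤ 2‖f‖` off `N`, so that
`|f y - f x| ≤ η + 2‖f‖ · 𝟙_{Nᶜ}`. [folklore] -/
theorem abs_sub_le_add_indicator (f : Ω →ᵇ ℝ) {η : ℝ} (hη : 0 ≤ η) (p : Ω × Ω) :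
    |f p.2 - f p.1| ≤
      η + Set.indicator {q : Ω × Ω | dist (f q.1) (f q.2) < η}ᶜ (fun _ => 2 * ‖f‖) p := by
  by_cases hp : dist (f p.1) (f p.2) < η
  · have hnot : p ∉ {q : Ω × Ω | dist (f q.1) (f q.2) < η}ᶜ := fun h => h hp
    rw [Set.indicator_of_notMem hnot, add_zero]
    rw [dist_comm, Real.dist_eq] at hp
    exact hp.le
  · have hmem : p ∈ {q : Ω × Ω | dist (f q.1) (f q.2) < η}ᶜ := hp
    rw [Set.indicator_of_mem hmem]
    have h1 : |f p.2 - f p.1| ≤ 2 * ‖f‖ := by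
      rw [← Real.dist_eq]
      exact f.dist_le_two_norm _ _
    linarith

variable [MeasurableSpace Ω] [OpensMeasurableSpace Ω]

/-- **Transfer of weak limits along asymptotic couplings** (Billingsley's "convergence together"
theorem, metric-free coupling form; a deliberate dot-notation extension of Mathlib's
`MeasureTheory.FiniteMeasure`).  Let `μs i → μ` weakly (finite Borel measures on a topological
space `Ω`).  Suppose that for every open, measurable neighbourhood `N` of the diagonal of
`Ω × Ω` and every `ε > 0`, eventually along `l` there is a coupling `π` of `μs i` and `νs i` (a
measure on `Ω × Ω` with first marginal `μs i` and second marginal `νs i`) with `π(Nᶜ) ≤ ε`.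
Then `νs i → μ` weakly.  Proof: for a bounded continuous `f` and `η > 0` take
`N = {dist (f x) (f y) < η}`; then
`|∫ f dνs i - ∫ f dμs i| = |∫ (f y - f x) dπ| ≤ η · mass (μs i) + 2‖f‖ · π(Nᶜ)`.
[cite: Billingsley1999, Thm. 3.1] -/
theorem _root_.MeasureTheory.FiniteMeasure.tendsto_of_forall_coupling {ι : Type*} {l : Filter ι}
    {μs νs : ι → FiniteMeasure Ω} {μ : FiniteMeasure Ω} (hμs : Tendsto μs l (𝓝 μ))
    (hc : ∀ N : Set (Ω × Ω), IsOpen N → MeasurableSet N → (∀ x, (x, x) ∈ N) → ∀ ε : ℝ, 0 < ε →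
      ∀ᶠ i in l, ∃ π : Measure (Ω × Ω), π.map Prod.fst = (μs i : Measure Ω) ∧
        π.map Prod.snd = (νs i : Measure Ω) ∧ π Nᶜ ≤ ENNReal.ofReal ε) :
    Tendsto νs l (𝓝 μ) := by
  have hint := FiniteMeasure.tendsto_iff_forall_integral_tendsto.1 hμs
  refine FiniteMeasure.tendsto_iff_forall_integral_tendsto.2 fun f => ?_
  rw [Metric.tendsto_nhds]
  intro ε hε
  -- constants
  set M : ℝ := (μ.mass : ℝ) + 1 with hM
  have hMpos : 0 < M := by positivity
  set η : ℝ := ε / (3 * M) with hη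
  have hηpos : 0 < η := by positivity
  set ε' : ℝ := ε / (3 * (2 * ‖f‖ + 1)) with hε'
  have hε'pos : 0 < ε' := by positivity
  -- the neighbourhood of the diagonal attached to `f` and `η`
  set N : Set (Ω × Ω) := {p | dist (f p.1) (f p.2) < η} with hN
  have hcont : Continuous fun p : Ω × Ω => dist (f p.1) (f p.2) :=
    (f.continuous.comp continuous_fst).dist (f.continuous.comp continuous_snd)
  have hNopen : IsOpen N := isOpen_lt hcont continuous_const
  have hmeas : Measurable fun p : Ω × Ω => dist (f p.1) (f p.2) :=
    (f.continuous.measurable.comp measurable_fst).dist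
      (f.continuous.measurable.comp measurable_snd)
  have hNmeas : MeasurableSet N := measurableSet_lt hmeas measurable_const
  have hNdiag : ∀ x, (x, x) ∈ N := fun x => by
    show dist (f x) (f x) < η
    rw [dist_self]; exact hηpos
  -- three eventualities
  have h1 := hc N hNopen hNmeas hNdiag ε' hε'pos
  have h2 : ∀ᶠ i in l, dist (∫ x, f x ∂(μs i : Measure Ω)) (∫ x, f x ∂(μ : Measure Ω)) < ε / 3 :=
    Metric.tendsto_nhds.1 (hint f) (ε / 3) (by positivity)
  have h3 : ∀ᶠ i in l, ((μs i).mass : ℝ) < M := by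
    have hmass : Tendsto (fun i => ((μs i).mass : ℝ)) l (𝓝 (μ.mass : ℝ)) :=
      (NNReal.continuous_coe.tendsto _).comp hμs.mass
    exact hmass.eventually (gt_mem_nhds (by linarith))
  filter_upwards [h1, h2, h3] with i hi1 hi2 hi3
  obtain ⟨π, hfst, hsnd, hπN⟩ := hi1
  -- `π` is a finite measure, of total mass that of `μs i`
  have hπuniv : π univ = ((μs i).mass : ℝ≥0∞) := by
    rw [FiniteMeasure.ennreal_mass, ← hfst, Measure.map_apply measurable_fst MeasurableSet.univ,
      preimage_univ]
  haveI : IsFiniteMeasure π := ⟨by rw [hπuniv]; exact ENNReal.coe_lt_top⟩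
  have hπreal : π.real univ = ((μs i).mass : ℝ) := by
    rw [measureReal_def, hπuniv, ENNReal.coe_toReal]
  -- the two integrals as integrals over `π`
  have hI1 : ∫ x, f x ∂(μs i : Measure Ω) = ∫ p, f p.1 ∂π := by
    rw [← hfst, integral_map measurable_fst.aemeasurable f.continuous.aestronglyMeasurable]
  have hI2 : ∫ x, f x ∂(νs i : Measure Ω) = ∫ p, f p.2 ∂π := by
    rw [← hsnd, integral_map measurable_snd.aemeasurable f.continuous.aestronglyMeasurable]
  -- integrability
  have hint1 : Integrable (fun p : Ω × Ω => f p.1) π :=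
    Integrable.of_bound (f.continuous.measurable.comp measurable_fst).aestronglyMeasurable ‖f‖
      (ae_of_all _ fun p => f.norm_coe_le_norm p.1)
  have hint2 : Integrable (fun p : Ω × Ω => f p.2) π :=
    Integrable.of_bound (f.continuous.measurable.comp measurable_snd).aestronglyMeasurable ‖f‖
      (ae_of_all _ fun p => f.norm_coe_le_norm p.2)
  have hintInd : Integrable (Set.indicator Nᶜ (fun _ : Ω × Ω => 2 * ‖f‖)) π :=
    (integrable_const _).indicator hNmeas.compl
  -- the bound on the difference
  have hdiff : |∫ p, f p.2 ∂π - ∫ p, f p.1 ∂π| ≤ η * M + 2 * ‖f‖ * ε' := by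
    rw [← integral_sub hint2 hint1]
    calc |∫ p, (f p.2 - f p.1) ∂π| ≤ ∫ p, |f p.2 - f p.1| ∂π := abs_integral_le_integral_abs
      _ ≤ ∫ p, (η + Set.indicator Nᶜ (fun _ : Ω × Ω => 2 * ‖f‖) p) ∂π := by
          refine integral_mono (hint2.sub hint1).abs ((integrable_const η).add hintInd) fun p => ?_
          exact abs_sub_le_add_indicator f hηpos.le p
      _ = η * π.real univ + π.real Nᶜ * (2 * ‖f‖) := by
          rw [integral_add (integrable_const η) hintInd, integral_const, integral_indicator_const _
            hNmeas.compl, smul_eq_mul, smul_eq_mul, mul_comm]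
      _ ≤ η * M + 2 * ‖f‖ * ε' := by
          have hN' : π.real Nᶜ ≤ ε' := ENNReal.toReal_le_of_le_ofReal hε'pos.le hπN
          have hu : π.real univ ≤ M := by rw [hπreal]; exact hi3.le
          have hf0 : 0 ≤ 2 * ‖f‖ := by positivity
          nlinarith [measureReal_nonneg (μ := π) (s := Nᶜ)]
  -- numerics
  have hηM : η * M = ε / 3 := by
    rw [hη]; field_simp
  have hfε : 2 * ‖f‖ * ε' < ε / 3 := by
    have hf0 : 0 ≤ 2 * ‖f‖ := by positivity
    have hlt : 2 * ‖f‖ / (2 * ‖f‖ + 1) < 1 := (div_lt_one (by positivity)).2 (by linarith)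
    have heq : 2 * ‖f‖ * ε' = (ε / 3) * (2 * ‖f‖ / (2 * ‖f‖ + 1)) := by
      rw [hε']
      field_simp
    rw [heq]
    calc (ε / 3) * (2 * ‖f‖ / (2 * ‖f‖ + 1)) < (ε / 3) * 1 :=
          mul_lt_mul_of_pos_left hlt (by positivity)
      _ = ε / 3 := mul_one _
  -- conclusion
  rw [hI2]
  rw [hI1] at hi2
  calc dist (∫ p, f p.2 ∂π) (∫ x, f x ∂(μ : Measure Ω))
      ≤ dist (∫ p, f p.2 ∂π) (∫ p, f p.1 ∂π) + dist (∫ p, f p.1 ∂π) (∫ x, f x ∂(μ : Measure Ω)) :=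
        dist_triangle _ _ _
    _ < (ε / 3 + ε / 3) + ε / 3 := by
        refine add_lt_add_of_le_of_lt ?_ hi2
        rw [Real.dist_eq]
        linarith
    _ = ε := by ring

/-- **Transfer of weak limits along asymptotic couplings, for probability measures** (the same
statement in Mathlib's `ProbabilityMeasure Ω`, i.e. for convergence in distribution; a deliberate
dot-notation extension of `MeasureTheory.ProbabilityMeasure`): if `μs i → μ` and for every open
measurable neighbourhood `N` of the diagonal and every `ε > 0`, eventually some coupling `π` of
`μs i` and `νs i` has `π(Nᶜ) ≤ ε`, then `νs i → μ`. [cite: Billingsley1999, Thm. 3.1] -/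
theorem _root_.MeasureTheory.ProbabilityMeasure.tendsto_of_forall_coupling {ι : Type*}
    {l : Filter ι} {μs νs : ι → ProbabilityMeasure Ω} {μ : ProbabilityMeasure Ω}
    (hμs : Tendsto μs l (𝓝 μ))
    (hc : ∀ N : Set (Ω × Ω), IsOpen N → MeasurableSet N → (∀ x, (x, x) ∈ N) → ∀ ε : ℝ, 0 < ε →
      ∀ᶠ i in l, ∃ π : Measure (Ω × Ω), π.map Prod.fst = (μs i : Measure Ω) ∧
        π.map Prod.snd = (νs i : Measure Ω) ∧ π Nᶜ ≤ ENNReal.ofReal ε) :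
    Tendsto νs l (𝓝 μ) := by
  rw [ProbabilityMeasure.tendsto_nhds_iff_toFiniteMeasure_tendsto_nhds] at hμs ⊢
  exact FiniteMeasure.tendsto_of_forall_coupling hμs hc

end Literature.Probability.Distributions

end
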